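import Literature.NumberTheory.Automorphic.AlgebraicWeightCohomologyModel
import Literature.NumberTheory.Automorphic.AlgebraicWeightStageLatticesFinite
import Literature.NumberTheory.Automorphic.FinitelyManyComponentsGLn
import Literature.NumberTheory.Automorphic.AdelicStabilizerArithmetic
import Literature.Algebra.Homology.GroupCohomologyFiniteTypeResolution
import HarnessLib

/-!
# The two finiteness inputs of Thm. V.4.1 from resolutions of finite type of the arithmetic groups

Topic `NumberTheory/Automorphic`; namespace `Literature.NumberTheory.Automorphic.AlgebraicWeight`.
Definitions with bodies and theorems; no named fact, no instance, no `sorry`.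

Let `FP` be the statement that every subgroup of `GL_n(K)` commensurable with `GL_n(𝓞_K)` (an
arithmetic group) admits, over every commutative ring `k`, a projective resolution of the trivial
module `k` by finitely generated free `k[Γ]`-modules — Borel–Serre [BorelSerre1973, §11.1]
(arithmetic groups are of type `(FL)`, in particular `FP_∞`; [Brown1982, VIII.9], [Serre1971,
§2.4 Thm. 4 and §1.8]).  Granted `FP` (a hypothesis `hFP` here), this file proves the two
properties of the integral models `H^q(Γ, indFun M_S)` (`Γ = GL_n(K)`, `M_S` the stage lattices)
used by `algebraicWeightEigenclass_continuousPoint_of_finiteness`: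

* `moduleFinite_cohomology_indFun_stageLattice_of_FP` (**HX**) — `H^q(Γ, indFun M_S)` is a
  finitely generated `ℤ_p`-module: Shapiro decomposition over the finitely many `Γ`-orbits on
  `GL_n(𝔸_K^∞)/U` (`exists_finset_orbit_cover`), each orbit stabiliser being arithmetic
  (`commensurable_orbitStabilizer_glIntegers`) hence `FP_∞`, and
  `moduleFinite_groupCohomology_of_finiteType_resolution`;
* `exists_stage_of_FP` (**HU**) — every class of `H^q(Γ, indFun V)` has a `p`-power multiple in
  the image of some `H^q(Γ, indFun M_S)`: `V = ⋃_{S,t} p^{-t} M_S` is a directed union of stable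
  lattices (`stageIndex`, `stageDiv`), cohomology of `FP_∞` groups commutes with it orbit by orbit
  (`exists_map_indFunMap_eq_of_directed`), and `p^{-t} M_S ≅ M_S` by multiplication by `p^t`
  (`exists_of_map_indFunMap_divLattice`).

## References

* P. Scholze, Ann. of Math. 182 (2015), §V.4, proof of Thm. V.4.1. [Scholze2015]
* A. Borel, J.-P. Serre, Comment. Math. Helv. 48 (1973), §11.1. [BorelSerre1973]
* K. S. Brown, *Cohomology of groups*, GTM 87, VIII (4.6), (5.1), §9. [Brown1982CohomologyGroups]
-/

noncomputable section

open CategoryTheory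
open IsDedekindDomain NumberField
open Literature.NumberTheory.Automorphic.BigHeckeGLn Literature.NumberTheory.Automorphic.TwistedQuotient

namespace Literature.NumberTheory.Automorphic

namespace AlgebraicWeight

variable (K : Type) [Field K] [NumberField K] (n p : ℕ) [Fact p.Prime]
  (lam : (K →+* PadicAlgCl p) → Fin n → ℤ)

/-! ### Orbit representatives for the level -/

/-- **A finite complete system of distinct representatives of the `GL_n(K)`-orbits on
`GL_n(𝔸_K^∞)/U`** (finiteness of the class number of `GL_n`). [cite: BorelIHES1963, Thm. 5.1] -/
theorem exists_orbit_representatives (𝒰 : TameLevel n K p) :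
    ∃ s : Finset (FiniteAdelicGL n K),
      (∀ x ∈ s, ∀ y ∈ s, (∃ γ : GL (Fin n) K, globalEmbedding n K γ • (x : FiniteAdelicGL n K ⧸ 𝒰.subgroup) =
        (y : FiniteAdelicGL n K ⧸ 𝒰.subgroup)) → x = y) ∧
      (∀ g : FiniteAdelicGL n K, ∃ x ∈ s, ∃ γ : GL (Fin n) K,
        globalEmbedding n K γ • (x : FiniteAdelicGL n K ⧸ 𝒰.subgroup) =
          (g : FiniteAdelicGL n K ⧸ 𝒰.subgroup)) := by
  classical
  obtain ⟨s₀, hs₀⟩ := exists_finset_orbit_cover K 𝒰.subgroup 𝒰.isOpen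
  obtain ⟨s, -, hdisj, hcov⟩ := exists_orbit_representatives_ind (globalEmbedding n K) 𝒰.subgroup
    (s₀.image Quotient.out) fun g => by
      obtain ⟨c, hc, γ, hγ⟩ := hs₀ (g : FiniteAdelicGL n K ⧸ 𝒰.subgroup)
      refine ⟨c.out, Finset.mem_image_of_mem _ hc, γ, ?_⟩
      rw [QuotientGroup.out_eq']
      exact hγ
  exact ⟨s, hdisj, hcov⟩

/-! ### HX: `H^q(Γ, indFun M_S)` is finitely generated -/

/-- **`H^q(Γ, indFun M_S)` is a finitely generated `ℤ_p`-module, granted `FP`.**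
[cite: Scholze2015, §V.4 (proof of Thm. V.4.1: "X_K is homotopy equivalent to a finite CW complex")]
[cite: BorelSerre1973, §11.1] -/
theorem moduleFinite_cohomology_indFun_stageLattice_of_FP
    (hFP : ∀ (K : Type) [Field K] [NumberField K] (n : ℕ) (Γx : Subgroup (GL (Fin n) K)),
      Γx.Commensurable (Matrix.GeneralLinearGroup.map (algebraMap (𝓞 K) K) :
        GL (Fin n) (𝓞 K) →* GL (Fin n) K).range →
      ∀ (k : Type) [CommRing k], ∃ P : ProjectiveResolution (Rep.trivial k Γx k),
        ∀ i, ∃ m : ℕ, Nonempty (P.complex.X i ≅ Rep.free k Γx (Fin m)))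
    (𝒰 : TameLevel n K p) {S : Finset (PadicAlgCl p)} (hS : ∀ c ∈ S, ‖c‖ ≤ 1) (q : ℕ) :
    Module.Finite ℤ_[p] (groupCohomology (indFun (globalEmbedding n K) 𝒰.subgroup
      (latticeRep 𝒰.subgroup (padicIntRep K n p lam) (stageLattice K n p lam S)
        (stageLattice_stable K n p lam 𝒰 S))) q) := by
  obtain ⟨s, -, hcov⟩ := exists_orbit_representatives K n p 𝒰
  refine moduleFinite_cohomology_indFun_of_finite_cover (globalEmbedding n K) 𝒰.subgroup _ s hcov q
    fun x _ => ?_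
  haveI : Module.Finite ℤ_[p] (indStabilizerRep (globalEmbedding n K) 𝒰.subgroup
      (latticeRep 𝒰.subgroup (padicIntRep K n p lam) (stageLattice K n p lam S)
        (stageLattice_stable K n p lam 𝒰 S)) x) :=
    moduleFinite_stageLattice K n p lam hS
  obtain ⟨P, hP⟩ := hFP K n (orbitStabilizer (globalEmbedding n K) 𝒰.subgroup
    (x : FiniteAdelicGL n K ⧸ 𝒰.subgroup))
    (commensurable_orbitStabilizer_glIntegers 𝒰.subgroup 𝒰.isOpen 𝒰.isCompact _) ℤ_[p]
  exact Literature.Algebra.Homology.moduleFinite_groupCohomology_of_finiteType_resolution P hP _ q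

/-! ### HU: the directed system of scaled stage lattices -/

/-- The index set of the stages: integral finite sets of scalars `S` and exponents `t`
(for `p^{-t} M_S`). [folklore] -/
abbrev StageIndex : Type :=
  {S : Finset (PadicAlgCl p) // ∀ c ∈ S, ‖c‖ ≤ 1} × ℕ

/-- The stage index set is directed. [folklore] -/
theorem stageIndex_isDirected : IsDirected (StageIndex p) (· ≤ ·) := by
  classical
  refine ⟨fun a b => ⟨(⟨a.1.1 ∪ b.1.1, fun c hc => ?_⟩, max a.2 b.2), ?_, ?_⟩⟩
  · rcases Finset.mem_union.1 hc with h | h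
    · exact a.1.2 c h
    · exact b.1.2 c h
  · exact ⟨Finset.subset_union_left, le_max_left _ _⟩
  · exact ⟨Finset.subset_union_right, le_max_right _ _⟩

/-- **The scaled stage lattice `p^{-t} M_S`.** [folklore] -/
abbrev stageDiv (i : StageIndex p) : Submodule ℤ_[p] (ResGLnCohomology.CoeffModule (PadicAlgCl p) n K lam) :=
  divLattice (((p ^ i.2 : ℕ) : ℤ_[p])) (stageLattice K n p lam i.1.1)

/-- `p^{-t} M_S` is stable under the level. [folklore] -/
theorem stageDiv_stable (𝒰 : TameLevel n K p) (i : StageIndex p) :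
    ∀ u ∈ 𝒰.subgroup, ∀ m ∈ stageDiv K n p lam i, padicIntRep K n p lam u m ∈ stageDiv K n p lam i :=
  divLattice_stable 𝒰.subgroup (padicIntRep K n p lam) _ _ (stageLattice_stable K n p lam 𝒰 i.1.1)

/-- **The scaled stage lattices are monotone in `(S, t)`.** [folklore] -/
theorem stageDiv_mono {i j : StageIndex p} (h : i ≤ j) : stageDiv K n p lam i ≤ stageDiv K n p lam j := by
  intro v hv
  rw [mem_divLattice_iff] at hv ⊢
  obtain ⟨d, hd⟩ := Nat.exists_eq_add_of_le h.2
  have hpow : (((p ^ j.2 : ℕ) : ℤ_[p])) = (((p ^ d : ℕ) : ℤ_[p])) * (((p ^ i.2 : ℕ) : ℤ_[p])) := by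
    rw [hd, pow_add, Nat.cast_mul, mul_comm]
  rw [hpow, mul_smul]
  exact Submodule.smul_mem _ _ (stageLattice_mono K n p lam h.1 hv)

/-- The stage representations. [folklore] -/
abbrev stageDivRep (𝒰 : TameLevel n K p) (i : StageIndex p) :
    Representation ℤ_[p] 𝒰.subgroup (stageDiv K n p lam i) :=
  latticeRep 𝒰.subgroup (padicIntRep K n p lam) (stageDiv K n p lam i) (stageDiv_stable K n p lam 𝒰 i)

/-- The inclusions `p^{-t} M_S ↪ V`. [folklore] -/
abbrev stageDivIncl (𝒰 : TameLevel n K p) (i : StageIndex p) :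
    (stageDivRep K n p lam 𝒰 i).IntertwiningMap
      (latticeRep 𝒰.subgroup (padicIntRep K n p lam) ⊤ (top_stable' K n p lam 𝒰.subgroup)) :=
  latticeIncl 𝒰.subgroup (padicIntRep K n p lam) le_top (stageDiv_stable K n p lam 𝒰 i)
    (top_stable' K n p lam 𝒰.subgroup)

/-- The transition maps `p^{-t} M_S ↪ p^{-t'} M_{S'}`. [folklore] -/
abbrev stageDivTrans (𝒰 : TameLevel n K p) ⦃i j : StageIndex p⦄ (h : i ≤ j) :
    (stageDivRep K n p lam 𝒰 i).IntertwiningMap (stageDivRep K n p lam 𝒰 j) :=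
  latticeIncl 𝒰.subgroup (padicIntRep K n p lam) (stageDiv_mono K n p lam h)
    (stageDiv_stable K n p lam 𝒰 i) (stageDiv_stable K n p lam 𝒰 j)

/-- The inclusions are compatible with the transition maps. [folklore] -/
theorem stageDivIncl_stageDivTrans (𝒰 : TameLevel n K p) ⦃i j : StageIndex p⦄ (h : i ≤ j)
    (v : stageDiv K n p lam i) :
    stageDivIncl K n p lam 𝒰 j (stageDivTrans K n p lam 𝒰 h v) = stageDivIncl K n p lam 𝒰 i v :=
  -- propositional rewriting with the API lemma: a definitional proof (`rfl`, `dsimp`) makes the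
  -- kernel compare the lattices of two different stages and times out
  Subtype.ext (by rw [coe_latticeIncl_apply, coe_latticeIncl_apply, coe_latticeIncl_apply])

/-- The inclusions are injective. [folklore] -/
theorem stageDivIncl_injective (𝒰 : TameLevel n K p) (i : StageIndex p) :
    Function.Injective (stageDivIncl K n p lam 𝒰 i) :=
  latticeIncl_injective 𝒰.subgroup (padicIntRep K n p lam) le_top _ _

/-- **`V = ⋃_{S,t} p^{-t} M_S`.** [cite: Scholze2015, §V.4 (M_ξ ⊗ ℚ̄_p = ξ)] -/
theorem stageDiv_cover (𝒰 : TameLevel n K p)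
    (v : (⊤ : Submodule ℤ_[p] (ResGLnCohomology.CoeffModule (PadicAlgCl p) n K lam))) :
    ∃ i : StageIndex p, ∃ w : stageDiv K n p lam i, stageDivIncl K n p lam 𝒰 i w = v := by
  obtain ⟨S, hS, t, ht⟩ := exists_pow_smul_mem_stageLattice K n p lam
    (v : ResGLnCohomology.CoeffModule (PadicAlgCl p) n K lam)
  exact ⟨(⟨S, hS⟩, t), ⟨(v : ResGLnCohomology.CoeffModule (PadicAlgCl p) n K lam),
    (mem_divLattice_iff _ _ _).2 ht⟩, Subtype.ext rfl⟩

/-! ### HU: every class has a `p`-power multiple coming from a stage -/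

/-- Every class of `H^q(Γ, indFun V)` comes from some stage `H^q(Γ, indFun p^{-t}M_S)`, granted
`FP` (`exists_map_indFunMap_eq_of_directed`). [cite: Brown1982CohomologyGroups, VIII (4.6)] -/
theorem exists_stageDiv_of_FP
    (hFP : ∀ (K : Type) [Field K] [NumberField K] (n : ℕ) (Γx : Subgroup (GL (Fin n) K)),
      Γx.Commensurable (Matrix.GeneralLinearGroup.map (algebraMap (𝓞 K) K) :
        GL (Fin n) (𝓞 K) →* GL (Fin n) K).range →
      ∀ (k : Type) [CommRing k], ∃ P : ProjectiveResolution (Rep.trivial k Γx k),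
        ∀ i, ∃ m : ℕ, Nonempty (P.complex.X i ≅ Rep.free k Γx (Fin m)))
    (𝒰 : TameLevel n K p) (q : ℕ)
    (y : groupCohomology (indFun (globalEmbedding n K) 𝒰.subgroup
      (latticeRep 𝒰.subgroup (padicIntRep K n p lam) ⊤ (top_stable' K n p lam 𝒰.subgroup))) q) :
    ∃ (i : StageIndex p) (y' : groupCohomology (indFun (globalEmbedding n K) 𝒰.subgroup
      (stageDivRep K n p lam 𝒰 i)) q),
      groupCohomology.map (MonoidHom.id _) (indFunMap (globalEmbedding n K) 𝒰.subgroup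
        (stageDivRep K n p lam 𝒰 i) _ (stageDivIncl K n p lam 𝒰 i)) q y' = y := by
  haveI : IsDirected (StageIndex p) (· ≤ ·) := stageIndex_isDirected p
  haveI : Nonempty (StageIndex p) := ⟨(⟨∅, fun c hc => absurd hc (Finset.notMem_empty c)⟩, 0)⟩
  obtain ⟨s, hdisj, hcov⟩ := exists_orbit_representatives K n p 𝒰
  have hFP' : ∀ x ∈ s, ∃ Px : ProjectiveResolution (Rep.trivial ℤ_[p]
      (orbitStabilizer (globalEmbedding n K) 𝒰.subgroup (x : FiniteAdelicGL n K ⧸ 𝒰.subgroup)) ℤ_[p]),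
      ∀ i, ∃ m : ℕ, Nonempty (Px.complex.X i ≅ Rep.free ℤ_[p]
        (orbitStabilizer (globalEmbedding n K) 𝒰.subgroup (x : FiniteAdelicGL n K ⧸ 𝒰.subgroup))
          (Fin m)) := fun x _ =>
    hFP K n _ (commensurable_orbitStabilizer_glIntegers 𝒰.subgroup 𝒰.isOpen 𝒰.isCompact _) ℤ_[p]
  exact exists_map_indFunMap_eq_of_directed (globalEmbedding n K) 𝒰.subgroup
    (latticeRep 𝒰.subgroup (padicIntRep K n p lam) ⊤ (top_stable' K n p lam 𝒰.subgroup))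
    (stageDivRep K n p lam 𝒰) (stageDivIncl K n p lam 𝒰) (stageDivIncl_injective K n p lam 𝒰)
    (stageDivTrans K n p lam 𝒰) (stageDivIncl_stageDivTrans K n p lam 𝒰) (stageDiv_cover K n p lam 𝒰)
    s hdisj hcov hFP' q y

/-- **Every class of `H^q(Γ, indFun V)` has a `p`-power multiple in the image of some
`H^q(Γ, indFun M_S)`, granted `FP`.** [cite: Scholze2015, §V.4 (proof of Thm. V.4.1)]
[cite: Brown1982CohomologyGroups, VIII (4.6)] -/
theorem exists_stage_of_FP
    (hFP : ∀ (K : Type) [Field K] [NumberField K] (n : ℕ) (Γx : Subgroup (GL (Fin n) K)),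
      Γx.Commensurable (Matrix.GeneralLinearGroup.map (algebraMap (𝓞 K) K) :
        GL (Fin n) (𝓞 K) →* GL (Fin n) K).range →
      ∀ (k : Type) [CommRing k], ∃ P : ProjectiveResolution (Rep.trivial k Γx k),
        ∀ i, ∃ m : ℕ, Nonempty (P.complex.X i ≅ Rep.free k Γx (Fin m)))
    (𝒰 : TameLevel n K p) (q : ℕ)
    (y : groupCohomology (indFun (globalEmbedding n K) 𝒰.subgroup
      (latticeRep 𝒰.subgroup (padicIntRep K n p lam) ⊤ (top_stable' K n p lam 𝒰.subgroup))) q) :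
    ∃ S : Finset (PadicAlgCl p), (∀ c ∈ S, ‖c‖ ≤ 1) ∧ ∃ (c : ℕ)
      (z : groupCohomology (indFun (globalEmbedding n K) 𝒰.subgroup
        (latticeRep 𝒰.subgroup (padicIntRep K n p lam) (stageLattice K n p lam S)
          (stageLattice_stable K n p lam 𝒰 S))) q),
      ((groupCohomology.functor ℤ_[p] (GL (Fin n) K) q).map
        (indInclTop K n p lam 𝒰.subgroup (stageLattice K n p lam S)
          (stageLattice_stable K n p lam 𝒰 S))).hom z = (((p ^ c : ℕ) : ℤ_[p])) • y := by
  obtain ⟨i, y', hy'⟩ := exists_stageDiv_of_FP K n p lam hFP 𝒰 q y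
  obtain ⟨z, hz⟩ := exists_of_map_indFunMap_divLattice (globalEmbedding n K) 𝒰.subgroup
    (padicIntRep K n p lam) (stageLattice K n p lam i.1.1) (stageLattice_stable K n p lam 𝒰 i.1.1)
    (p ^ i.2) (top_stable' K n p lam 𝒰.subgroup) le_top le_top q y y' hy'
  refine ⟨i.1.1, i.1.2, i.2, z, ?_⟩
  rw [Nat.cast_smul_eq_nsmul]
  exact hz

end AlgebraicWeight

end Literature.NumberTheory.Automorphic
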